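import Literature.Analysis.FluidPDE.DriftHeatInteriorLipschitz
import Literature.Analysis.FluidPDE.DriftHeatLocalComparison
import Literature.Analysis.FluidPDE.HarnackChainCover
import Literature.Analysis.FluidPDE.KNSSSwirlLiouville
import HarnessLib

/-!
# KNSS 2009, Lemma 2.1 (stability of the strong maximum principle): proof

Analysis/FluidPDE proofs file discharging the named fact
`Literature.Analysis.FluidPDE.KNSS2009_lemma21` (`KNSSSwirlLiouville`; Koch–Nadirashvili–
Seregin–Šverák, *Liouville theorems for the Navier–Stokes equations and applications*, Acta
Math. 203 (2009) = arXiv:0709.3599, **Lemma 2.1**, p. 5) **unconditionally**, by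
`Literature.Analysis.FluidPDE.KNSS2009_lemma21_holds`, for the elementary solution class in which
the fact is vendored (the tree's `IsDriftHeatSolutionOn`, `DriftHeatLocalClass`: `C²` slices,
jointly continuous `∇u`, `Δu`, time-integrated equation, bounded measurable drift `‖a‖ ≤ A`).
The tree's `KNSSLemma21OfHarnack` proves the same fact *from* the interior Harnack inequality
`Lieberman1996_harnack_drift` (a named fact); here no Harnack or regularity input is used: the
equicontinuity behind the printed compactness proof is the interior Lipschitz estimate of
`DriftHeatInteriorLipschitz` (Ishii–Lions), and positivity is propagated by Lieberman's
expanding-paraboloid barrier with the local comparison principle of `DriftHeatLocalComparison`.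

Contents:
* `IsDriftHeatSolutionOn.spread` — **Lieberman 1996, Ch. II, Lemma 2.6** inside `Ω`: if `g ≥ 0`
  is a solution near `B̄(y_c, L) ⊆ Ω` and `g(t_b, ·) ≥ h` on `B̄(y_c, εL)`, then
  `g(t_T, ·) ≥ (h/2) ε^{2q}/ε⁴` on `B̄(y_c, L/2)` (the barrier of `LiebermanBarrier` and
  `IsDriftHeatSolutionOn.paraboloid_comparison`; the proof of `spread_of_positivity`,
  `KNSSSpreadOfPositivity`, for the local class);
* `IsDriftHeatSolutionOn.le_of_cylinder` — **short-time localisation**: if `g ≤ B` on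
  `[t_b, t_e] × B̄(x_c, r)` and `g(t_b, ·) ≤ η` on `B̄(x_c, r)`, then
  `g(t_e, x_c) ≤ η + B (2n + 2Ar)(t_e − t_b)/r²`;
* `IsDriftHeatSolutionOn.spread_chain` — iteration of `spread` along a chain of centres;
* `KNSS2009_lemma21_holds`.

## Proof of Lemma 2.1

KNSS argue by contradiction and compactness, using the interior regularity of [LSU] for
`uₜ + a·∇u − Δu = 0` and the strong maximum principle for a limit equation. Here the proof is
direct and quantitative. With `g = M − u ≥ 0`:

1. **Chains** (`HarnackChainCover`): `B̄_{r₀}(closure Ω' ∪ K)` lies in a compact connected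
   `S' ⊆ Ω` with a margin `L` (`B̄(z, L) ⊆ Ω` for `z ∈ S'`), and any two points of `S'` are joined
   by a chain of at most `N` points of `S'` with steps `< L/4` (`exists_uniform_chain`), padded to
   exactly `N` steps.
2. **Smallness at earlier times**: if `g(s, z) > η₀M` for some `s ∈ [τ/2, T − θ]`, `z ∈ S'`, then
   `g(s, ·) ≥ η₀M/2` on a ball `B̄(z, ρ*)` (Lipschitz estimate), and `N + 1` applications of
   Lieberman's spreading lemma along a chain from `z` to `x₀ ∈ K` over `[s, T]` give
   `g(T, x₀) ≥ 2δM`, contradicting `u(T, x₀) ≥ M(1 − δ)`. Hence `g ≤ η₀M = εM/4` on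
   `[τ/2, T − θ] × S'`.
3. **Times close to `T`** (`IsDriftHeatSolutionOn.le_of_cylinder`): for `t ∈ (T − θ, T)` and
   `x ∈ Ω'`, comparison on the cylinder `B̄(x, r₀) × [t − θ, t]` with the bottom values `≤ η₀M`
   gives `g(t, x) ≤ η₀M + 2M(2n + 2Ar₀)θ/r₀² ≤ 3εM/4`.
All constants (`r₀, L, N, ρ, ρ*, θ, q, δ`) depend only on `Ω, Ω', K, T, τ, A, ε` (and `dim E`).

## References

* G. Koch, N. Nadirashvili, G. Seregin, V. Šverák, Acta Math. 203 (2009) 83–105 =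
  arXiv:0709.3599, Lemma 2.1 (p. 5). [KochNadirashviliSereginSverak2009]
* G. M. Lieberman, *Second Order Parabolic Differential Equations*, World Scientific (1996),
  Ch. II, Lemmas 2.3, 2.6, Cor. 2.5 (pp. 8–11). [Lieberman1996]
-/

noncomputable section

open MeasureTheory Set Function Filter TopologicalSpace InnerProductSpace Metric
open scoped RealInnerProductSpace Laplacian ContDiff Topology

namespace Literature.Analysis.FluidPDE

variable {E : Type*} [NormedAddCommGroup E] [InnerProductSpace ℝ E] [FiniteDimensional ℝ E]

/-! ### The Laplacian of `|x − c|²` -/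

section LaplacianNormSq

/-- `Δ |x − c|² = 2n`, `n = dim E`. [folklore] -/
theorem laplacian_norm_sub_sq (c x : E) :
    (Δ (fun z : E => ‖z - c‖ ^ 2)) x = 2 * (Module.finrank ℝ E : ℝ) := by
  set b := stdOrthonormalBasis ℝ E
  have hsmooth : ContDiffOn ℝ 2 (fun z : E => ‖z - c‖ ^ 2) univ :=
    ((contDiff_id.sub contDiff_const).norm_sq ℝ).contDiffOn
  have h1 : ∀ i, iteratedFDeriv ℝ 2 (fun z : E => ‖z - c‖ ^ 2) x ![b i, b i] = 2 := by
    intro i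
    have hline := hasDerivAt_fderiv_line isOpen_univ hsmooth (mem_univ x) (b i) (b i)
    have hD : (fun σ : ℝ => fderiv ℝ (fun z : E => ‖z - c‖ ^ 2) (x + σ • b i) (b i)) =
        fun σ => 2 * ⟪x + σ • b i - c, b i⟫ := by
      funext σ
      rw [(hasFDerivAt_norm_sub_sq c (x + σ • b i)).fderiv]
      simp only [FunLike.coe_smul, Pi.smul_apply, innerSL_apply_apply, smul_eq_mul]
    rw [hD] at hline
    have h2 := (hasDerivAt_inner_line x (b i) c 0).const_mul 2
    rw [hline.unique h2, b.orthonormal.1 i]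
    norm_num
  rw [congrFun (laplacian_eq_iteratedFDeriv_orthonormalBasis _ b) x]
  simp only [h1, Finset.sum_const, Finset.card_univ, Fintype.card_fin, nsmul_eq_mul]
  ring

end LaplacianNormSq

section Spread

variable [MeasurableSpace E] [BorelSpace E]
variable {Ω : Set E} {S : Set ℝ} {A : ℝ} {a : ℝ → E → E} {g : ℝ → E → ℝ}

/-! ### Spreading of positivity (Lieberman 1996, Lemma 2.6) inside `Ω` -/

/-- **Spreading of positivity inside `Ω`** (Lieberman 1996, Ch. II, Lemma 2.6, for the local
class). Let `g` be a solution of the local class on `S × Ω` (`Ω` open), nonnegative on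
`[t_b, t_T] × B̄(y_c, L)` where `B̄(y_c, L) ⊆ Ω` and `[t_b, t_T] ⊆ S`, `t_b < t_T`; let
`0 < ε ≤ 1/2`,
`m = (1 − ε²)L²/(t_T − t_b)`, and `q ≥ 2` natural with `32 m q ≥ (8 + 4n + 4AL + 2m)²`. If
`g(t_b, ·) ≥ h > 0` on `B̄(y_c, εL)`, then `g(t_T, ·) ≥ (h/2) ε^{2q}/ε⁴` on `B̄(y_c, L/2)`. Proof
as printed (and as in `spread_of_positivity`): the barrier `v = c ψ`, `ψ = (P − |x − y_c|²)²/P^q`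
along `P(t) = ε²L² + m(t − t_b)` is a subsolution for every drift `|a| ≤ A`, lies below `g` on the
parabolic boundary, hence inside by `IsDriftHeatSolutionOn.paraboloid_comparison`. [cite: Lieberman1996, Ch. II Lemma 2.6 (pp. 10–11)] -/
theorem IsDriftHeatSolutionOn.spread (hg : IsDriftHeatSolutionOn a g A S Ω) (hΩ : IsOpen Ω)
    (hA0 : 0 ≤ A) {yc : E} {t_b t_T L ε h : ℝ} (hS : Icc t_b t_T ⊆ S) (htb : t_b < t_T)
    (hL : 0 < L) (hLΩ : closedBall yc L ⊆ Ω) (hε0 : 0 < ε) (hε1 : ε ≤ 1 / 2) (hh : 0 < h)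
    {q : ℕ} (hq2 : 2 ≤ q)
    (hq : (8 + 4 * (Module.finrank ℝ E : ℝ) + 4 * A * L +
        2 * ((1 - ε ^ 2) * L ^ 2 / (t_T - t_b))) ^ 2 ≤
      32 * ((1 - ε ^ 2) * L ^ 2 / (t_T - t_b)) * q)
    (hg0 : ∀ t ∈ Icc t_b t_T, ∀ x ∈ closedBall yc L, 0 ≤ g t x)
    (hbottom : ∀ x, ‖x - yc‖ ≤ ε * L → h ≤ g t_b x) :
    ∀ x, ‖x - yc‖ ≤ L / 2 → h / 2 * (ε ^ 2) ^ q / ε ^ 4 ≤ g t_T x := by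
  -- constants
  set n : ℝ := (Module.finrank ℝ E : ℝ) with hn
  set p₀ : ℝ := ε ^ 2 * L ^ 2 with hp₀
  have hp₀pos : 0 < p₀ := by positivity
  set m : ℝ := (1 - ε ^ 2) * L ^ 2 / (t_T - t_b) with hm
  have hε2 : ε ^ 2 ≤ 1 / 4 := by nlinarith only [hε0, hε1]
  have hmpos : 0 < m := by
    have : 0 < 1 - ε ^ 2 := by linarith only [hε2]
    positivity
  set P : ℝ → ℝ := fun t => p₀ + m * (t - t_b) with hP
  have hPc : Continuous P := by rw [hP]; fun_prop
  have hPtb : P t_b = p₀ := by simp [hP]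
  have hPtT : P t_T = L ^ 2 := by
    have hd : t_T - t_b ≠ 0 := by linarith
    simp only [hP, hp₀, hm]
    field_simp
    ring
  have hPge : ∀ t ∈ Icc t_b t_T, p₀ ≤ P t := fun t ht => by
    simp only [hP]; nlinarith only [ht.1, hmpos.le]
  have hPle : ∀ t ∈ Icc t_b t_T, P t ≤ L ^ 2 := fun t ht => by
    rw [← hPtT]; simp only [hP]; nlinarith only [ht.2, hmpos.le]
  have hPpos : ∀ t ∈ Icc t_b t_T, 0 < P t := fun t ht => hp₀pos.trans_le (hPge t ht)
  have hq0 : q ≠ 0 := by omega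
  set c : ℝ := h * p₀ ^ q / p₀ ^ 2 with hc
  have hcpos : 0 < c := by positivity
  -- the barrier and its time derivative
  set v : ℝ → E → ℝ := fun t x => (P t - ‖x - yc‖ ^ 2) ^ 2 / (P t ^ q / c) with hv
  set vt : ℝ → E → ℝ := fun t x =>
    c * (m * (2 * (P t - ‖x - yc‖ ^ 2) - q * (P t - ‖x - yc‖ ^ 2) ^ 2 / P t) / P t ^ q) with hvt
  have H1 : ContinuousOn (uncurry v) (Icc t_b t_T ×ˢ univ) := by
    have hnum : Continuous fun p : ℝ × E => (P p.1 - ‖p.2 - yc‖ ^ 2) ^ 2 := by fun_prop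
    have hden : Continuous fun p : ℝ × E => P p.1 ^ q / c := by fun_prop
    refine (hnum.continuousOn.div hden.continuousOn fun p hp => ?_)
    exact div_ne_zero (pow_ne_zero _ (hPpos p.1 hp.1).ne') hcpos.ne'
  have H2 : ∀ t, ContDiff ℝ 2 (v t) := fun t => contDiff_paraboloidBarrier yc (P t) (P t ^ q / c)
  have H3 : ∀ x, ∀ t ∈ Icc t_b t_T, HasDerivAt (fun τ => v τ x) (vt t x) t := by
    intro x t ht
    have hPt : p₀ + m * (t - t_b) ≠ 0 := (hPpos t ht).ne'
    have h1 := (hasDerivAt_paraboloidBarrier_time p₀ m t_b (‖x - yc‖ ^ 2) hq0 hPt).const_mul c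
    have hfun : (fun τ => v τ x) = fun τ => c * ((p₀ + m * (τ - t_b) - ‖x - yc‖ ^ 2) ^ 2 /
        (p₀ + m * (τ - t_b)) ^ q) := by
      funext τ
      simp only [hv, hP]
      rw [div_div_eq_mul_div]
      ring
    rw [hfun]
    exact h1.congr_deriv (by simp only [hvt, hP])
  have hP1 : ContinuousOn (fun τ => P τ) (Icc t_b t_T) := hPc.continuousOn
  have hP0' : ∀ τ ∈ Icc t_b t_T, P τ ≠ 0 := fun τ hτ => (hPpos τ hτ).ne'
  have hPq0 : ∀ τ ∈ Icc t_b t_T, P τ ^ q / c ≠ 0 := fun τ hτ =>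
    div_ne_zero (pow_ne_zero _ (hP0' τ hτ)) hcpos.ne'
  have H4 : ∀ x, ContinuousOn (fun τ => vt τ x) (Icc t_b t_T) := by
    intro x
    simp only [hvt]
    refine continuousOn_const.mul ((continuousOn_const.mul ?_).div (hP1.pow q)
      fun τ hτ => pow_ne_zero _ (hP0' τ hτ))
    exact (continuousOn_const.mul (hP1.sub continuousOn_const)).sub
      ((continuousOn_const.mul ((hP1.sub continuousOn_const).pow 2)).div hP1 hP0')
  have H5 : ∀ x, ContinuousOn (fun τ => fderiv ℝ (v τ) x) (Icc t_b t_T) := by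
    intro x
    have hD : (fun τ => fderiv ℝ (v τ) x) =
        fun τ => (-(4 * (P τ - ‖x - yc‖ ^ 2) / (P τ ^ q / c))) • innerSL ℝ (x - yc) :=
      funext fun τ => (hasFDerivAt_paraboloidBarrier yc (P τ) (P τ ^ q / c) x).fderiv
    rw [hD]
    have hsc : ContinuousOn (fun τ => -(4 * (P τ - ‖x - yc‖ ^ 2) / (P τ ^ q / c))) (Icc t_b t_T) :=
      ((continuousOn_const.mul (hP1.sub continuousOn_const)).div ((hP1.pow q).div_const c)
        hPq0).neg
    exact ContinuousOn.smul (f := fun τ => -(4 * (P τ - ‖x - yc‖ ^ 2) / (P τ ^ q / c)))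
      (g := fun _ => innerSL ℝ (x - yc)) hsc continuousOn_const
  have H6 : ∀ x, ContinuousOn (fun τ => (Δ (v τ)) x) (Icc t_b t_T) := by
    intro x
    have hΔ : (fun τ => (Δ (v τ)) x) = fun τ =>
        (8 * ‖x - yc‖ ^ 2 - 4 * n * (P τ - ‖x - yc‖ ^ 2)) / (P τ ^ q / c) :=
      funext fun τ => laplacian_paraboloidBarrier yc (P τ) (P τ ^ q / c) x
    rw [hΔ]
    exact (continuousOn_const.sub (continuousOn_const.mul (hP1.sub continuousOn_const))).div
      ((hP1.pow q).div_const c) hPq0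
  have H7 : ∀ t ∈ Ioc t_b t_T, ∀ x, ‖x - yc‖ ^ 2 < P t →
      vt t x ≤ (Δ (v t)) x - A * ‖fderiv ℝ (v t) x‖ := by
    intro t ht x hx
    have htI : t ∈ Icc t_b t_T := Ioc_subset_Icc_self ht
    have hPt : 0 < P t := hPpos t htI
    have hPq : 0 < P t ^ q := pow_pos hPt q
    set r : ℝ := ‖x - yc‖ ^ 2 with hr
    set S : ℝ := P t - r with hS
    have hS0 : 0 < S := by rw [hS]; linarith only [hx]
    have hdL : ‖x - yc‖ ≤ L :=
      (pow_le_pow_iff_left₀ (norm_nonneg _) hL.le two_ne_zero).1 (hx.le.trans (hPle t htI))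
    have hΔv : (Δ (v t)) x = (8 * r - 4 * n * S) / (P t ^ q / c) :=
      laplacian_paraboloidBarrier yc (P t) (P t ^ q / c) x
    have hNv : ‖fderiv ℝ (v t) x‖ = |4 * S / (P t ^ q / c)| * ‖x - yc‖ :=
      norm_fderiv_paraboloidBarrier yc (P t) (P t ^ q / c) x
    have habs : |4 * S / (P t ^ q / c)| = 4 * S * c / P t ^ q := by
      rw [abs_of_pos (by positivity), div_div_eq_mul_div]
    have key := paraboloidBarrier_ineq (n := n) (q := (q : ℝ)) hPt hS0.le hdL hA0 hq
    have hr' : r = P t - S := by rw [hS]; ring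
    have e1 : vt t x = (c / P t ^ q) * (m * (2 * S - q * S ^ 2 / P t)) := by
      simp only [hvt, hS, hr]; ring
    have e2 : (Δ (v t)) x = (c / P t ^ q) * (8 * (P t - S) - 4 * n * S) := by
      rw [hΔv, hr', div_div_eq_mul_div]; ring
    have e3 : A * ‖fderiv ℝ (v t) x‖ = (c / P t ^ q) * (A * (4 * S * ‖x - yc‖)) := by
      rw [hNv, habs]; ring
    rw [e1, e2, e3, ← mul_sub]
    exact mul_le_mul_of_nonneg_left key (div_pos hcpos hPq).le
  have H15 : ∀ x, ‖x - yc‖ ^ 2 ≤ P t_b → v t_b x ≤ g t_b x := by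
    intro x hx
    rw [hPtb] at hx
    have hxL : ‖x - yc‖ ≤ ε * L := by
      refine (pow_le_pow_iff_left₀ (norm_nonneg _) (by positivity) two_ne_zero).1 ?_
      rw [mul_pow]; exact hx
    refine le_trans ?_ (hbottom x hxL)
    show (P t_b - ‖x - yc‖ ^ 2) ^ 2 / (P t_b ^ q / c) ≤ h
    rw [hPtb]
    have h1 : (p₀ - ‖x - yc‖ ^ 2) ^ 2 ≤ p₀ ^ 2 := by
      have : 0 ≤ p₀ - ‖x - yc‖ ^ 2 := by linarith only [hx]
      exact pow_le_pow_left₀ this (by linarith only [sq_nonneg ‖x - yc‖]) 2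
    have h2 : (p₀ - ‖x - yc‖ ^ 2) ^ 2 / (p₀ ^ q / c) ≤ p₀ ^ 2 / (p₀ ^ q / c) :=
      div_le_div_of_nonneg_right h1 (by positivity)
    refine h2.trans (le_of_eq ?_)
    simp only [hc]
    field_simp
  have H16 : ∀ t ∈ Icc t_b t_T, ∀ x, ‖x - yc‖ ^ 2 = P t → v t x ≤ g t x := by
    intro t ht x hx
    have h0 : v t x = 0 := by simp only [hv, hx, sub_self]; simp
    rw [h0]
    refine hg0 t ht x (mem_closedBall_iff_norm.2 ?_)
    exact (pow_le_pow_iff_left₀ (norm_nonneg _) hL.le two_ne_zero).1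
      (hx.le.trans (hPle t ht))
  have hPU : ∀ t ∈ Icc t_b t_T, ∀ x, ‖x - yc‖ ^ 2 ≤ P t → x ∈ Ω := fun t ht x hx =>
    hLΩ (mem_closedBall_iff_norm.2 ((pow_le_pow_iff_left₀ (norm_nonneg _) hL.le two_ne_zero).1
      (hx.trans (hPle t ht))))
  have hcomp := hg.paraboloid_comparison hΩ hS hPc hPU H1 (fun t _ => H2 t) H3 H4 H5 H6 H7 H15 H16
  -- evaluation at the top time
  intro x hx
  have htTI : t_T ∈ Icc t_b t_T := ⟨htb.le, le_rfl⟩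
  have hr4 : ‖x - yc‖ ^ 2 ≤ L ^ 2 / 4 := by nlinarith only [hx, norm_nonneg (x - yc)]
  have hxP : ‖x - yc‖ ^ 2 ≤ P t_T := by rw [hPtT]; nlinarith only [hr4, sq_nonneg L]
  have hvg := hcomp t_T htTI x hxP
  refine le_trans ?_ hvg
  show h / 2 * (ε ^ 2) ^ q / ε ^ 4 ≤ (P t_T - ‖x - yc‖ ^ 2) ^ 2 / (P t_T ^ q / c)
  rw [hPtT]
  set r : ℝ := ‖x - yc‖ ^ 2 with hr
  have hK : (L ^ 2 - r) ^ 2 / ((L ^ 2) ^ q / c) =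
      (h * (ε ^ 2) ^ q / ε ^ 4) * ((L ^ 2 - r) ^ 2 / L ^ 4) := by
    simp only [hc, hp₀, mul_pow]
    field_simp
  rw [hK]
  have hfrac : 1 / 2 ≤ (L ^ 2 - r) ^ 2 / L ^ 4 := by
    rw [div_le_div_iff₀ (by norm_num) (by positivity)]
    have h1 : 3 * L ^ 2 / 4 ≤ L ^ 2 - r := by linarith only [hr4]
    have h2 : (3 * L ^ 2 / 4) * (3 * L ^ 2 / 4) ≤ (L ^ 2 - r) * (L ^ 2 - r) :=
      mul_self_le_mul_self (by positivity) h1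
    nlinarith only [h2, sq_nonneg (L ^ 2)]
  have hKpos : 0 ≤ h * (ε ^ 2) ^ q / ε ^ 4 := by positivity
  calc h / 2 * (ε ^ 2) ^ q / ε ^ 4 = (h * (ε ^ 2) ^ q / ε ^ 4) * (1 / 2) := by ring
    _ ≤ (h * (ε ^ 2) ^ q / ε ^ 4) * ((L ^ 2 - r) ^ 2 / L ^ 4) :=
        mul_le_mul_of_nonneg_left hfrac hKpos

/-! ### Short-time localisation: an upper bound at the centre of a cylinder -/

/-- **Short-time localisation bound** (a comparison argument of the type of Lieberman 1996,
Ch. II, Lemma 2.3/Cor. 2.5, with the barrier `w = η + B(|x − x_c|² + k(t − t_b))/r²`,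
`k = 2n + 2Ar`, a supersolution of `wₜ ≥ Δw + A|∇w|`): if `g` is a solution of the local class
near `B̄(x_c, r) ⊆ Ω`, `g ≤ B` on `[t_b, t_e] × B̄(x_c, r)` (`B ≥ 0`) and `g(t_b, ·) ≤ η` on
`B̄(x_c, r)` (`η ≥ 0`), then `g(t_e, x_c) ≤ η + B k (t_e − t_b)/r²`: information cannot enter the
centre from the lateral boundary faster than the barrier allows. (Applied to `−g`, which is in
the class, and `v = −w` in `IsDriftHeatSolutionOn.paraboloid_comparison` with constant `P ≡ r²`.) [cite: Lieberman1996, Ch. II Cor. 2.5 (comparison principle)] -/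
theorem IsDriftHeatSolutionOn.le_of_cylinder (hg : IsDriftHeatSolutionOn a g A S Ω)
    (hΩ : IsOpen Ω) (hA0 : 0 ≤ A) {xc : E} {r t_b t_e η B : ℝ} (hr : 0 < r)
    (hrΩ : closedBall xc r ⊆ Ω) (hS : Icc t_b t_e ⊆ S) (hbe : t_b ≤ t_e) (hB : 0 ≤ B)
    (hη : 0 ≤ η)
    (hgB : ∀ t ∈ Icc t_b t_e, ∀ x ∈ closedBall xc r, g t x ≤ B)
    (hbot : ∀ x ∈ closedBall xc r, g t_b x ≤ η) :
    g t_e xc ≤ η + B * (2 * (Module.finrank ℝ E : ℝ) + 2 * A * r) * (t_e - t_b) / r ^ 2 := by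
  set n : ℝ := (Module.finrank ℝ E : ℝ) with hn
  have hn0 : 0 ≤ n := by rw [hn]; positivity
  set k : ℝ := 2 * n + 2 * A * r with hk
  have hk0 : 0 ≤ k := by rw [hk]; positivity
  have hg' := hg.neg
  set κ' : ℝ := -(B / r ^ 2) with hκ'
  -- the barrier `v = -w`
  set v : ℝ → E → ℝ := fun t x => κ' * ‖x - xc‖ ^ 2 + (-η - B * k / r ^ 2 * (t - t_b)) with hv
  set vt : ℝ → E → ℝ := fun _ _ => -(B * k / r ^ 2) with hvt
  have hvD : ∀ t x, HasFDerivAt (v t) (κ' • ((2 : ℝ) • innerSL ℝ (x - xc))) x := fun t x =>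
    ((hasFDerivAt_norm_sub_sq xc x).const_mul κ').add_const _
  have hvΔ : ∀ t x, (Δ (v t)) x = κ' * (2 * n) := by
    intro t x
    have h1 : v t = (fun x => κ' * ‖x - xc‖ ^ 2) + fun _ => -η - B * k / r ^ 2 * (t - t_b) := by
      funext x; simp only [hv, Pi.add_apply]
    have hsm : ContDiff ℝ 2 (fun x : E => ‖x - xc‖ ^ 2) := (contDiff_id.sub contDiff_const).norm_sq ℝ
    have hsm' : ContDiffAt ℝ 2 (fun x : E => κ' * ‖x - xc‖ ^ 2) x :=
      (contDiff_const.mul hsm).contDiffAt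
    rw [h1, hsm'.laplacian_add contDiffAt_const, laplacian_const]
    have h2 : (fun x : E => κ' * ‖x - xc‖ ^ 2) = κ' • fun x : E => ‖x - xc‖ ^ 2 := by
      funext x; simp [smul_eq_mul]
    rw [h2, laplacian_smul κ' hsm.contDiffAt, laplacian_norm_sub_sq, hn, smul_eq_mul]
    simp
  have H1 : ContinuousOn (uncurry v) (Icc t_b t_e ×ˢ univ) := by
    have : Continuous (uncurry v) := by simp only [hv]; fun_prop
    exact this.continuousOn
  have H2 : ∀ t, ContDiff ℝ 2 (v t) := by
    intro t
    simp only [hv]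
    exact (contDiff_const.mul ((contDiff_id.sub contDiff_const).norm_sq ℝ)).add contDiff_const
  have H3 : ∀ x, ∀ t ∈ Icc t_b t_e, HasDerivAt (fun τ => v τ x) (vt t x) t := by
    intro x t _
    simp only [hv, hvt]
    have h1 : HasDerivAt (fun τ : ℝ => -η - B * k / r ^ 2 * (τ - t_b)) (-(B * k / r ^ 2 * 1)) t := by
      simpa using (((hasDerivAt_id t).sub_const t_b).const_mul (B * k / r ^ 2)).const_sub (-η)
    have h2 := h1.const_add (κ' * ‖x - xc‖ ^ 2)
    exact h2.congr_deriv (by ring)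
  have H4 : ∀ x, ContinuousOn (fun τ => vt τ x) (Icc t_b t_e) := fun x => continuousOn_const
  have H5 : ∀ x, ContinuousOn (fun τ => fderiv ℝ (v τ) x) (Icc t_b t_e) := by
    intro x
    have : (fun τ => fderiv ℝ (v τ) x) = fun _ => κ' • ((2 : ℝ) • innerSL ℝ (x - xc)) :=
      funext fun τ => (hvD τ x).fderiv
    rw [this]
    exact continuousOn_const
  have H6 : ∀ x, ContinuousOn (fun τ => (Δ (v τ)) x) (Icc t_b t_e) := by
    intro x
    have : (fun τ => (Δ (v τ)) x) = fun _ => κ' * (2 * n) := funext fun τ => hvΔ τ x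
    rw [this]
    exact continuousOn_const
  have H7 : ∀ t ∈ Ioc t_b t_e, ∀ x, ‖x - xc‖ ^ 2 < (fun _ : ℝ => r ^ 2) t →
      vt t x ≤ (Δ (v t)) x - A * ‖fderiv ℝ (v t) x‖ := by
    intro t _ x hx
    have hxr : ‖x - xc‖ < r := (pow_lt_pow_iff_left₀ (norm_nonneg _) hr.le two_ne_zero).1 hx
    rw [hvΔ t x, (hvD t x).fderiv, norm_smul, norm_smul, innerSL_apply_norm, Real.norm_two, hκ',
      norm_neg, Real.norm_eq_abs, abs_of_nonneg (by positivity)]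
    simp only [hvt, hk]
    have hr2 : 0 < r ^ 2 := by positivity
    rw [show -(B * (2 * n + 2 * A * r) / r ^ 2) = -(B / r ^ 2) * (2 * n) - A * (B / r ^ 2 * (2 * r))
      by field_simp; ring]
    have : A * (B / r ^ 2 * (2 * ‖x - xc‖)) ≤ A * (B / r ^ 2 * (2 * r)) := by
      apply mul_le_mul_of_nonneg_left _ hA0
      apply mul_le_mul_of_nonneg_left _ (by positivity)
      linarith only [hxr]
    linarith only [this]
  have hbot' : ∀ x, ‖x - xc‖ ^ 2 ≤ (fun _ : ℝ => r ^ 2) t_b → v t_b x ≤ (fun t x => -g t x) t_b x := by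
    intro x hx
    have hxr : x ∈ closedBall xc r := mem_closedBall_iff_norm.2
      ((pow_le_pow_iff_left₀ (norm_nonneg _) hr.le two_ne_zero).1 hx)
    have h1 := hbot x hxr
    have h2 : κ' * ‖x - xc‖ ^ 2 ≤ 0 := by
      rw [hκ']; exact mul_nonpos_of_nonpos_of_nonneg (by simp; positivity) (sq_nonneg _)
    simp only [hv, sub_self, mul_zero, sub_zero]
    linarith only [h1, h2]
  have hside' : ∀ t ∈ Icc t_b t_e, ∀ x, ‖x - xc‖ ^ 2 = (fun _ : ℝ => r ^ 2) t →
      v t x ≤ (fun t x => -g t x) t x := by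
    intro t ht x hx
    simp only at hx
    have hxn : ‖x - xc‖ = r := by
      have h := congrArg Real.sqrt hx
      rwa [Real.sqrt_sq (norm_nonneg _), Real.sqrt_sq hr.le] at h
    have hxr : x ∈ closedBall xc r := mem_closedBall_iff_norm.2 hxn.le
    have h1 := hgB t ht x hxr
    have h2 : κ' * ‖x - xc‖ ^ 2 = -B := by
      rw [hx, hκ']; field_simp
    have h3 : 0 ≤ B * k / r ^ 2 * (t - t_b) := by
      have : 0 ≤ t - t_b := by linarith [ht.1]
      positivity
    simp only [hv, h2]
    linarith only [h1, h3, hη]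
  have hPU : ∀ t ∈ Icc t_b t_e, ∀ x, ‖x - xc‖ ^ 2 ≤ (fun _ : ℝ => r ^ 2) t → x ∈ Ω :=
    fun t _ x hx => hrΩ (mem_closedBall_iff_norm.2
      ((pow_le_pow_iff_left₀ (norm_nonneg _) hr.le two_ne_zero).1 hx))
  have hcomp := hg'.paraboloid_comparison hΩ hS (P := fun _ => r ^ 2) continuous_const hPU H1
    (fun t _ => H2 t) H3 H4 H5 H6 H7 hbot' hside'
  have h := hcomp t_e ⟨hbe, le_rfl⟩ xc (by simp; positivity)
  simp only [hv, sub_self, norm_zero] at h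
  have : B * (2 * n + 2 * A * r) * (t_e - t_b) / r ^ 2 = B * k / r ^ 2 * (t_e - t_b) := by
    rw [hk]; ring
  rw [this]
  have e0 : κ' * (0 : ℝ) ^ 2 = 0 := by ring
  linarith [h, e0]

/-! ### Chains of spreads -/

/-- The Lieberman factor per chain step: `(1/2) (ε²)^q / ε⁴` with `ε = 1/4`. [folklore] -/
def liebermanChainFactor (q : ℕ) : ℝ := 1 / 2 * (((1 : ℝ) / 4) ^ 2) ^ q / ((1 : ℝ) / 4) ^ 4

/-- The chain factor is positive. [folklore] -/
theorem liebermanChainFactor_pos (q : ℕ) : 0 < liebermanChainFactor q := by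
  unfold liebermanChainFactor; positivity

/-- **Chain of spreads.** Let `g ≥ 0` be a solution of the local class on `S × Ω` and
`c₀, …, c_N` centres with `B̄(cᵢ, L) ⊆ Ω` and `dist(cᵢ, c_{i+1}) ≤ L/4`; fix a start time `s` and a
step `Δt > 0` with `[s, s + (N + 1)Δt] ⊆ S`, and `q` admissible for Lieberman's lemma with
`ε = 1/4` on intervals of length `Δt`. If `g(s + Δt, ·) ≥ h₁ > 0` on `B̄(c₀, L/2)`, then
`g(s + (i + 1)Δt, ·) ≥ h₁ · liebermanChainFactor(q)^i` on `B̄(cᵢ, L/2)` for every `i ≤ N` (induction on `i`: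
`B̄(c_{i+1}, L/4) ⊆ B̄(cᵢ, L/2)` and `IsDriftHeatSolutionOn.spread` with `ε = 1/4`). [cite: Lieberman1996, Ch. II Lemma 2.6 (iterated)] -/
theorem IsDriftHeatSolutionOn.spread_chain (hg : IsDriftHeatSolutionOn a g A S Ω)
    (hΩ : IsOpen Ω) (hA0 : 0 ≤ A) {L s Δt h₁ : ℝ} {N q : ℕ} {c : ℕ → E} (hL : 0 < L)
    (hΔt : 0 < Δt) (hS : Icc s (s + (N + 1) * Δt) ⊆ S)
    (hstat : ∀ i ≤ N, closedBall (c i) L ⊆ Ω)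
    (hstep : ∀ i < N, dist (c i) (c (i + 1)) ≤ L / 4) (hq2 : 2 ≤ q)
    (hq : (8 + 4 * (Module.finrank ℝ E : ℝ) + 4 * A * L +
        2 * ((1 - (1 / 4 : ℝ) ^ 2) * L ^ 2 / Δt)) ^ 2 ≤
      32 * ((1 - (1 / 4 : ℝ) ^ 2) * L ^ 2 / Δt) * q)
    (hg0 : ∀ t ∈ S, ∀ x ∈ Ω, 0 ≤ g t x) (hh₁ : 0 < h₁)
    (hstart : ∀ x ∈ closedBall (c 0) (L / 2), h₁ ≤ g (s + Δt) x) :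
    ∀ i ≤ N, ∀ x ∈ closedBall (c i) (L / 2), h₁ * liebermanChainFactor q ^ i ≤ g (s + (i + 1) * Δt) x := by
  intro i
  induction i with
  | zero =>
    intro _ x hx
    simpa using hstart x hx
  | succ i ih =>
    intro hi x hx
    have hi' : i ≤ N := Nat.le_of_succ_le hi
    have hiN : i < N := hi
    -- positivity on the small ball around `c (i+1)` at time `s + (i+1)Δt`
    have hsub : closedBall (c (i + 1)) (1 / 4 * L) ⊆ closedBall (c i) (L / 2) := by
      intro y hy
      rw [mem_closedBall] at hy ⊢
      have h1 := dist_triangle y (c (i + 1)) (c i)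
      have h2 : dist (c (i + 1)) (c i) ≤ L / 4 := by rw [dist_comm]; exact hstep i hiN
      linarith only [h1, h2, hy]
    have hprev : ∀ y, ‖y - c (i + 1)‖ ≤ 1 / 4 * L →
        h₁ * liebermanChainFactor q ^ i ≤ g (s + (i + 1) * Δt) y := by
      intro y hy
      exact ih hi' y (hsub (mem_closedBall_iff_norm.2 hy))
    -- the spread on `[s + (i+1)Δt, s + (i+2)Δt]` centred at `c (i+1)`
    have ht1 : s ≤ s + (i + 1) * Δt := by
      have : 0 ≤ (i + 1 : ℝ) * Δt := by positivity
      linarith only [this]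
    have ht2 : s + (i + 1) * Δt < s + (i + 1 + 1) * Δt := by nlinarith only [hΔt]
    have ht3 : s + (i + 1 + 1) * Δt ≤ s + (N + 1) * Δt := by
      have h1 : ((i + 1 + 1 : ℕ) : ℝ) ≤ (N + 1 : ℝ) := by exact_mod_cast Nat.succ_le_succ hi
      push_cast at h1
      nlinarith only [h1, hΔt]
    have hS' : Icc (s + (i + 1) * Δt) (s + (i + 1 + 1) * Δt) ⊆ S := fun t ht =>
      hS ⟨ht1.trans ht.1, ht.2.trans ht3⟩
    have hdiff : s + (i + 1 + 1) * Δt - (s + (i + 1) * Δt) = Δt := by ring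
    have hq' : (8 + 4 * (Module.finrank ℝ E : ℝ) + 4 * A * L +
        2 * ((1 - (1 / 4 : ℝ) ^ 2) * L ^ 2 / (s + (i + 1 + 1) * Δt - (s + (i + 1) * Δt)))) ^ 2 ≤
        32 * ((1 - (1 / 4 : ℝ) ^ 2) * L ^ 2 / (s + (i + 1 + 1) * Δt - (s + (i + 1) * Δt))) * q := by
      rw [hdiff]; exact hq
    have hpos : 0 < h₁ * liebermanChainFactor q ^ i := mul_pos hh₁ (pow_pos (liebermanChainFactor_pos q) i)
    have hg0' : ∀ t ∈ Icc (s + (i + 1) * Δt) (s + (i + 1 + 1) * Δt),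
        ∀ x ∈ closedBall (c (i + 1)) L, 0 ≤ g t x := fun t ht x hx =>
      hg0 t (hS' ht) x (hstat (i + 1) hi hx)
    have hsp := hg.spread hΩ hA0 hS' ht2 hL (hstat (i + 1) hi) (by norm_num : (0 : ℝ) < 1 / 4)
      (by norm_num : (1 / 4 : ℝ) ≤ 1 / 2) hpos hq2 hq' hg0' hprev x (mem_closedBall_iff_norm.1 hx)
    have hcf : h₁ * liebermanChainFactor q ^ i / 2 * (((1 : ℝ) / 4) ^ 2) ^ q / ((1 : ℝ) / 4) ^ 4 =
        h₁ * liebermanChainFactor q ^ (i + 1) := by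
      rw [pow_succ, liebermanChainFactor]; ring
    rw [hcf] at hsp
    push_cast
    exact hsp

end Spread


/-! ### Padding a chain to a prescribed number of steps -/

section Pad

omit [InnerProductSpace ℝ E] [FiniteDimensional ℝ E] in
/-- A chain `z 0, …, z L` in a set `S'` (steps `< R`) ending at `q` may be padded to exactly `N ≥ L`
steps by resting at `q`. [folklore] -/
theorem exists_chain_pad {S' : Set E} {R : ℝ} (hR : 0 < R) {p q : E} {L N : ℕ} (hLN : L ≤ N)
    {z : ℕ → E} (h0 : z 0 = p) (hL : z L = q) (hzS : ∀ i ≤ L, z i ∈ S')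
    (hstep : ∀ i < L, dist (z i) (z (i + 1)) < R) :
    ∃ c : ℕ → E, c 0 = p ∧ c N = q ∧ (∀ i ≤ N, c i ∈ S') ∧ ∀ i < N, dist (c i) (c (i + 1)) < R := by
  have hqS : q ∈ S' := hL ▸ hzS L le_rfl
  refine ⟨fun i => if i ≤ L then z i else q, by simp [h0], ?_, ?_, ?_⟩
  · show (if N ≤ L then z N else q) = q
    by_cases h : N ≤ L
    · have hNL : N = L := le_antisymm h hLN
      rw [if_pos h, hNL, hL]
    · rw [if_neg h]
  · intro i _
    show (if i ≤ L then z i else q) ∈ S'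
    by_cases h : i ≤ L
    · rw [if_pos h]; exact hzS i h
    · rw [if_neg h]; exact hqS
  · intro i _
    show dist (if i ≤ L then z i else q) (if i + 1 ≤ L then z (i + 1) else q) < R
    by_cases h : i + 1 ≤ L
    · rw [if_pos (Nat.le_of_succ_le h), if_pos h]; exact hstep i h
    · by_cases h' : i ≤ L
      · have hi : i = L := by omega
        subst hi
        rw [if_pos h', if_neg h, hL, dist_self]; exact hR
      · rw [if_neg h', if_neg h, dist_self]; exact hR

end Pad

/-! ### The proof of Lemma 2.1 -/

section Assembly

variable (E)
variable [MeasurableSpace E] [BorelSpace E]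

set_option maxHeartbeats 800000 in
/-- **KNSS 2009, Lemma 2.1 (stability of the strong maximum principle), discharged**
(Koch–Nadirashvili–Seregin–Šverák, Acta Math. 203 (2009) = arXiv:0709.3599, Lemma 2.1, p. 5),
for the elementary solution class of the named fact `KNSS2009_lemma21`: the constant `δ`
depends only on `Ω, Ω', K, T, τ, ε` and the drift bound `A` (and `dim E`). Proof: chains in a
compact connected envelope (`HarnackChainCover`), the interior Lipschitz estimate
(`IsDriftHeatSolutionOn.abs_sub_le_lipConst`), Lieberman's spreading of positivity along the
chain (`IsDriftHeatSolutionOn.spread`, `IsDriftHeatSolutionOn.spread_chain`) and the short-time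
localisation bound (`IsDriftHeatSolutionOn.le_of_cylinder`); see the module docstring. [cite: KochNadirashviliSereginSverak2009, Lemma 2.1 (arXiv p. 5)] -/
theorem KNSS2009_lemma21_holds : KNSS2009_lemma21 E := by
  intro Ω Ω' K T τ A ε hΩo hΩb hΩc hΩ' hK hKΩ hτ hε
  -- trivial case `T ≤ τ`
  by_cases hT : T ≤ τ
  · refine ⟨1, one_pos, ?_⟩
    intro a u M _ _ _ _ _ _ _ _ _ t ht
    exact absurd (ht.1.trans ht.2) (not_lt.2 hT)
  push Not at hT
  have hT0 : 0 < T := hτ.trans hT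
  -- the compact set `C₀ = closure Ω' ∪ K`
  have hΩ'b : Bornology.IsBounded Ω' := hΩb.subset (subset_closure.trans hΩ')
  have hC₀c : IsCompact (closure Ω' ∪ K) := hΩ'b.isCompact_closure.union hK
  have hC₀Ω : closure Ω' ∪ K ⊆ Ω := union_subset hΩ' hKΩ
  rcases (closure Ω' ∪ K).eq_empty_or_nonempty with hC₀e | hC₀ne
  · refine ⟨1, one_pos, ?_⟩
    intro a u M _ _ _ _ _ _ _ _ hx
    obtain ⟨x, hxK, -⟩ := hx
    have hx' : x ∈ closure Ω' ∪ K := Or.inr hxK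
    rw [hC₀e] at hx'
    exact absurd hx' (notMem_empty x)
  -- `r₀`, `C = B̄_{r₀}(C₀)`, a compact connected envelope `S'` of `C` in `Ω`, its margin `L`
  obtain ⟨δ₀, hδ₀, hδ₀Ω⟩ := hC₀c.exists_cthickening_subset_open hΩo hC₀Ω
  obtain ⟨r₀, hr₀⟩ : ∃ r₀ : ℝ, r₀ = δ₀ / 2 := ⟨_, rfl⟩
  have hr₀pos : 0 < r₀ := by rw [hr₀]; positivity
  have hr₀δ : r₀ ≤ δ₀ := by rw [hr₀]; linarith only [hδ₀]
  obtain ⟨C, hC⟩ : ∃ C : Set E, C = cthickening r₀ (closure Ω' ∪ K) := ⟨_, rfl⟩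
  have hCc : IsCompact C := by rw [hC]; exact hC₀c.cthickening
  have hCΩ : C ⊆ Ω := by rw [hC]; exact (cthickening_mono hr₀δ _).trans hδ₀Ω
  have hC₀C : closure Ω' ∪ K ⊆ C := by rw [hC]; exact self_subset_cthickening _
  have hCne : C.Nonempty := hC₀ne.mono hC₀C
  obtain ⟨S', hS'c, hS'conn, hCS', hS'Ω⟩ :=
    exists_isCompact_isConnected_superset hΩo hΩc hCc hCΩ hCne
  obtain ⟨L, hL, hLΩ⟩ := hS'c.exists_cthickening_subset_open hΩo hS'Ω
  have hstatC : ∀ z ∈ S', closedBall z L ⊆ Ω := fun z hz =>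
    (closedBall_subset_cthickening hz L).trans hLΩ
  have hballC : ∀ x ∈ closure Ω' ∪ K, closedBall x r₀ ⊆ S' := fun x hx => by
    refine Subset.trans ?_ hCS'
    rw [hC]; exact closedBall_subset_cthickening hx r₀
  have hΩ'C : Ω' ⊆ S' := fun x hx => hCS' (hC₀C (Or.inl (subset_closure hx)))
  have hKC : K ⊆ S' := fun x hx => hCS' (hC₀C (Or.inr hx))
  have hS'Ω' : S' ⊆ Ω := hS'Ω
  -- uniform chains of steps `< L/4` in `S'`
  obtain ⟨N, hchain⟩ := exists_uniform_chain hS'c hS'conn.isPreconnected (R := L / 4)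
    (by positivity)
  -- constants
  obtain ⟨n, hn⟩ : ∃ n : ℝ, n = (Module.finrank ℝ E : ℝ) := ⟨_, rfl⟩
  have hn0 : 0 ≤ n := by rw [hn]; positivity
  obtain ⟨A', hA'⟩ : ∃ A' : ℝ, A' = max A 0 := ⟨_, rfl⟩
  have hA'0 : 0 ≤ A' := by rw [hA']; exact le_max_right _ _
  have hAA' : A ≤ A' := by rw [hA']; exact le_max_left _ _
  obtain ⟨ρ, hρ⟩ : ∃ ρ : ℝ, ρ = min (L / 2) (min 1 (τ / 4)) := ⟨_, rfl⟩
  have hρpos : 0 < ρ := by rw [hρ]; exact lt_min (by positivity) (lt_min one_pos (by positivity))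
  have hρL : ρ ≤ L / 2 := by rw [hρ]; exact min_le_left _ _
  have hρ1 : ρ ≤ 1 := by rw [hρ]; exact (min_le_right _ _).trans (min_le_left _ _)
  have hρτ : ρ ≤ τ / 4 := by rw [hρ]; exact (min_le_right _ _).trans (min_le_right _ _)
  have hρ2τ : ρ ^ 2 ≤ τ / 4 := by nlinarith only [hρpos, hρ1, hρτ]
  obtain ⟨KL, hKL⟩ : ∃ KL : ℝ, KL = lipConst A' ρ n := ⟨_, rfl⟩
  have hKLpos : 0 < KL := by rw [hKL]; exact lipConst_pos hA'0 hρpos hn0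
  obtain ⟨dL, hdL⟩ : ∃ dL : ℝ, dL = lipRad A' ρ := ⟨_, rfl⟩
  have hdLpos : 0 < dL := by rw [hdL]; exact lipRad_pos hA'0 hρpos
  have hdLρ : dL ≤ ρ := by rw [hdL]; exact lipRad_le hA'0 hρpos
  obtain ⟨η₀, hη₀⟩ : ∃ η₀ : ℝ, η₀ = ε / 4 := ⟨_, rfl⟩
  have hη₀pos : 0 < η₀ := by rw [hη₀]; positivity
  obtain ⟨ρs, hρs⟩ : ∃ ρs : ℝ, ρs = min dL (η₀ / (4 * KL)) := ⟨_, rfl⟩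
  have hρspos : 0 < ρs := by rw [hρs]; exact lt_min hdLpos (by positivity)
  have hρsdL : ρs ≤ dL := by rw [hρs]; exact min_le_left _ _
  have hρsK : ρs ≤ η₀ / (4 * KL) := by rw [hρs]; exact min_le_right _ _
  have hρsL : ρs ≤ L / 2 := hρsdL.trans (hdLρ.trans hρL)
  obtain ⟨kk, hkk⟩ : ∃ kk : ℝ, kk = 2 * n + 2 * A' * r₀ := ⟨_, rfl⟩
  have hkk0 : 0 ≤ kk := by rw [hkk]; positivity
  obtain ⟨θ, hθ⟩ : ∃ θ : ℝ, θ = min (τ / 2) (ε * r₀ ^ 2 / (4 * (kk + 1))) := ⟨_, rfl⟩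
  have hθpos : 0 < θ := by rw [hθ]; exact lt_min (by positivity) (by positivity)
  have hθτ : θ ≤ τ / 2 := by rw [hθ]; exact min_le_left _ _
  have hθk : θ ≤ ε * r₀ ^ 2 / (4 * (kk + 1)) := by rw [hθ]; exact min_le_right _ _
  -- Lieberman's exponent, uniform over the admissible time steps
  obtain ⟨mlo, hmlo⟩ : ∃ mlo : ℝ, mlo = 3 / 4 * L ^ 2 * (N + 1) / T := ⟨_, rfl⟩
  obtain ⟨mhi, hmhi⟩ : ∃ mhi : ℝ, mhi = L ^ 2 * (N + 1) / θ := ⟨_, rfl⟩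
  have hmlopos : 0 < mlo := by rw [hmlo]; positivity
  have hmhipos : 0 < mhi := by rw [hmhi]; positivity
  obtain ⟨Fhi, hFhi⟩ : ∃ Fhi : ℝ, Fhi = 8 + 4 * n + 4 * A' * L + 2 * mhi := ⟨_, rfl⟩
  obtain ⟨q, hq⟩ : ∃ q : ℕ, q = ⌈Fhi ^ 2 / (32 * mlo)⌉₊ + 2 := ⟨_, rfl⟩
  have hq2 : 2 ≤ q := by rw [hq]; omega
  have hqF : Fhi ^ 2 ≤ 32 * mlo * q := by
    have h1 : Fhi ^ 2 / (32 * mlo) ≤ ⌈Fhi ^ 2 / (32 * mlo)⌉₊ := Nat.le_ceil _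
    have h2 : (q : ℝ) = ⌈Fhi ^ 2 / (32 * mlo)⌉₊ + 2 := by rw [hq]; push_cast; ring
    rw [h2]
    calc Fhi ^ 2 = Fhi ^ 2 / (32 * mlo) * (32 * mlo) := by field_simp
      _ ≤ (⌈Fhi ^ 2 / (32 * mlo)⌉₊ : ℝ) * (32 * mlo) :=
          mul_le_mul_of_nonneg_right h1 (by positivity)
      _ ≤ ((⌈Fhi ^ 2 / (32 * mlo)⌉₊ : ℝ) + 2) * (32 * mlo) := by nlinarith only [hmlopos]
      _ = 32 * mlo * ((⌈Fhi ^ 2 / (32 * mlo)⌉₊ : ℝ) + 2) := by ring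
  have hN1 : (0 : ℝ) < N + 1 := by positivity
  have hqOK : ∀ ε' Δt : ℝ, 0 < ε' → ε' ≤ 1 / 2 → θ / (N + 1) ≤ Δt → Δt ≤ T / (N + 1) →
      0 < Δt →
      (8 + 4 * n + 4 * A' * L + 2 * ((1 - ε' ^ 2) * L ^ 2 / Δt)) ^ 2 ≤
        32 * ((1 - ε' ^ 2) * L ^ 2 / Δt) * q := by
    intro ε' Δt hε'0 hε'1 hΔ1 hΔ2 hΔ0
    obtain ⟨m, hm⟩ : ∃ m : ℝ, m = (1 - ε' ^ 2) * L ^ 2 / Δt := ⟨_, rfl⟩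
    rw [← hm]
    have hε'2 : ε' ^ 2 ≤ 1 / 4 := by nlinarith only [hε'0, hε'1]
    have hL2 : 0 ≤ L ^ 2 := sq_nonneg L
    have hm_lo : mlo ≤ m := by
      rw [hmlo, hm, div_le_div_iff₀ hT0 hΔ0]
      have h1 : (N + 1) * Δt ≤ T := by rwa [le_div_iff₀ hN1, mul_comm] at hΔ2
      have h2 : 3 / 4 ≤ 1 - ε' ^ 2 := by linarith only [hε'2]
      calc 3 / 4 * L ^ 2 * (N + 1) * Δt = 3 / 4 * (L ^ 2 * ((N + 1) * Δt)) := by ring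
        _ ≤ 3 / 4 * (L ^ 2 * T) := by gcongr
        _ ≤ (1 - ε' ^ 2) * (L ^ 2 * T) := mul_le_mul_of_nonneg_right h2 (by positivity)
        _ = (1 - ε' ^ 2) * L ^ 2 * T := by ring
    have hm_hi : m ≤ mhi := by
      rw [hmhi, hm, div_le_div_iff₀ hΔ0 hθpos]
      have h1 : θ ≤ (N + 1) * Δt := by rwa [div_le_iff₀ hN1, mul_comm] at hΔ1
      have h2 : 1 - ε' ^ 2 ≤ 1 := by nlinarith only [hε'0]
      have h3 : 0 ≤ 1 - ε' ^ 2 := by linarith only [hε'2]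
      calc (1 - ε' ^ 2) * L ^ 2 * θ ≤ 1 * L ^ 2 * θ := by gcongr
        _ = L ^ 2 * θ := by ring
        _ ≤ L ^ 2 * ((N + 1) * Δt) := by gcongr
        _ = L ^ 2 * (N + 1) * Δt := by ring
    have hm0 : 0 ≤ m := hmlopos.le.trans hm_lo
    have hF0 : 0 ≤ 8 + 4 * n + 4 * A' * L + 2 * m := by positivity
    have hFle : 8 + 4 * n + 4 * A' * L + 2 * m ≤ Fhi := by rw [hFhi]; linarith only [hm_hi]
    calc (8 + 4 * n + 4 * A' * L + 2 * m) ^ 2 ≤ Fhi ^ 2 := pow_le_pow_left₀ hF0 hFle 2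
      _ ≤ 32 * mlo * q := hqF
      _ ≤ 32 * m * q := by gcongr
  obtain ⟨ε₀, hε₀⟩ : ∃ ε₀ : ℝ, ε₀ = ρs / L := ⟨_, rfl⟩
  have hε₀pos : 0 < ε₀ := by rw [hε₀]; positivity
  have hε₀half : ε₀ ≤ 1 / 2 := by rw [hε₀, div_le_iff₀ hL]; linarith only [hρsL]
  have hε₀L : ε₀ * L = ρs := by rw [hε₀]; field_simp
  obtain ⟨c₀, hc₀⟩ : ∃ c₀ : ℝ, c₀ = 1 / 2 * (ε₀ ^ 2) ^ q / ε₀ ^ 4 := ⟨_, rfl⟩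
  have hc₀pos : 0 < c₀ := by rw [hc₀]; positivity
  have hc₁pos : 0 < liebermanChainFactor q := liebermanChainFactor_pos q
  obtain ⟨δ, hδ⟩ : ∃ δ : ℝ, δ = c₀ * liebermanChainFactor q ^ N * η₀ / 4 := ⟨_, rfl⟩
  have hδpos : 0 < δ := by rw [hδ]; positivity
  refine ⟨δ, hδpos, ?_⟩
  intro a u M hmeas hdrift hC2 hcD hcΔ heq hM hbound hnear t ht x hx
  -- the class, for `u` and for `g = M − u`
  have hu : IsDriftHeatSolutionOn a u A' (Ioc 0 T) Ω :=
    { measurable_drift := hmeas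
      norm_drift_le := fun t ht x hx => (hdrift t ht x hx).trans hAA'
      contDiffOn := hC2
      continuousOn_fderiv := hcD
      continuousOn_laplacian := hcΔ
      integral_eq := fun x hx s hs t ht hst => heq x hx s t hs.1 hst ht.2 }
  have hg : IsDriftHeatSolutionOn a (fun t x => M - u t x) A' (Ioc 0 T) Ω := by
    have hfun : (fun t x => M - u t x) = fun t x => -u t x + M := by
      funext t x; ring
    rw [hfun]
    exact hu.neg.add_const hΩo ordConnected_Ioc M
  have hg0 : ∀ t ∈ Ioc 0 T, ∀ x ∈ Ω, 0 ≤ M - u t x := fun t ht x hx => by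
    linarith only [(abs_le.1 (hbound t ht x hx)).2]
  have hg2 : ∀ t ∈ Ioc 0 T, ∀ x ∈ Ω, M - u t x ≤ 2 * M := fun t ht x hx => by
    linarith only [(abs_le.1 (hbound t ht x hx)).1]
  have hgabs : ∀ t ∈ Ioc 0 T, ∀ x ∈ Ω, |M - u t x| ≤ 2 * M := fun t ht x hx =>
    abs_le.2 ⟨by linarith only [hg0 t ht x hx, hM], hg2 t ht x hx⟩
  obtain ⟨x₀, hx₀K, hx₀⟩ := hnear
  have hgT : M - u T x₀ ≤ δ * M := by linarith only [hx₀]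
  ------------------------------------------------------------------
  -- Claim 1: smallness at earlier times on `C`
  ------------------------------------------------------------------
  have claim1 : ∀ s ∈ Icc (τ / 2) (T - θ), ∀ z ∈ S', M - u s z ≤ η₀ * M := by
    intro s hs z hz
    by_contra hcon
    push Not at hcon
    have hs0 : 0 < s := by linarith only [hs.1, hτ]
    have hsT : s ≤ T := by linarith only [hs.2, hθpos]
    have hzL : closedBall z L ⊆ Ω := hstatC z hz
    -- Lipschitz estimate at `(s, z)`
    have hball2ρ : closedBall z (2 * ρ) ⊆ Ω :=
      (closedBall_subset_closedBall (by linarith only [hρL])).trans hzL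
    have hsρ : (0 : ℝ) < s - ρ ^ 2 := by linarith only [hs.1, hρ2τ, hτ]
    have hIccS : Icc (s - ρ ^ 2) s ⊆ Ioc 0 T := fun t' ht' => ⟨hsρ.trans_le ht'.1, ht'.2.trans hsT⟩
    have hbd' : ∀ t' ∈ Icc (s - ρ ^ 2) s, ∀ y ∈ closedBall z (2 * ρ),
        |(fun t x => M - u t x) t' y| ≤ 2 * M := fun t' ht' y hy =>
      hgabs t' (hIccS ht') y (hball2ρ hy)
    have h2M : (0 : ℝ) < 2 * M := by positivity
    have hlip := hg.abs_sub_le_lipConst hΩo hρpos h2M hball2ρ hIccS hbd'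
    have hball : ∀ y, ‖y - z‖ ≤ ε₀ * L → η₀ * M / 2 ≤ M - u s y := by
      intro y hy
      rw [hε₀L] at hy
      have hyd : y ∈ closedBall z (lipRad A' ρ) := by
        rw [← hdL]; exact mem_closedBall_iff_norm.2 (hy.trans hρsdL)
      have h1 := hlip y hyd
      have h2 : lipConst A' ρ (Module.finrank ℝ E) * (2 * M) * ‖y - z‖ ≤ η₀ * M / 2 := by
        have hK : lipConst A' ρ (Module.finrank ℝ E) = KL := by rw [hKL, hn]
        rw [hK]
        have hyK : ‖y - z‖ ≤ η₀ / (4 * KL) := hy.trans hρsK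
        calc KL * (2 * M) * ‖y - z‖ ≤ KL * (2 * M) * (η₀ / (4 * KL)) := by gcongr
          _ = η₀ * M / 2 := by field_simp; ring
      have h3 := (abs_le.1 (h1.trans h2)).1
      linarith only [h3, hcon]
    -- the time step
    obtain ⟨Δt, hΔt⟩ : ∃ Δt : ℝ, Δt = (T - s) / (N + 1) := ⟨_, rfl⟩
    have hΔtpos : 0 < Δt := by rw [hΔt]; exact div_pos (by linarith only [hs.2, hθpos]) hN1
    have hΔt1 : θ / (N + 1) ≤ Δt := by
      rw [hΔt]; exact div_le_div_of_nonneg_right (by linarith only [hs.2]) hN1.le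
    have hΔt2 : Δt ≤ T / (N + 1) := by
      rw [hΔt]; exact div_le_div_of_nonneg_right (by linarith only [hs0]) hN1.le
    have hsΔT : s + (N + 1) * Δt = T := by rw [hΔt]; field_simp; ring
    have hs1T : s + Δt ≤ T := by
      have hNn : (0 : ℝ) ≤ N := Nat.cast_nonneg N
      have : Δt ≤ (N + 1) * Δt := by nlinarith only [hΔtpos, hNn]
      linarith only [this, hsΔT]
    -- the chain from `z` to `x₀`, padded to `N` steps
    obtain ⟨Lz, hLzN, z', hz'0, hz'L, hz'S, hz'step⟩ := hchain z hz x₀ (hKC hx₀K)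
    obtain ⟨c, hc0, hcN, hcS, hcstep⟩ :=
      exists_chain_pad (by positivity : (0 : ℝ) < L / 4) hLzN hz'0 hz'L hz'S hz'step
    have hcstat : ∀ i ≤ N, closedBall (c i) L ⊆ Ω := fun i hi => hstatC (c i) (hcS i hi)
    have hcstep' : ∀ i < N, dist (c i) (c (i + 1)) ≤ L / 4 := fun i hi => (hcstep i hi).le
    -- spread 0: from `B̄(z, ρ*)` at time `s` to `B̄(z, L/2)` at time `s + Δt`
    have hq0 := hqOK ε₀ Δt hε₀pos hε₀half hΔt1 hΔt2 hΔtpos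
    have hq0' : (8 + 4 * (Module.finrank ℝ E : ℝ) + 4 * A' * L +
        2 * ((1 - ε₀ ^ 2) * L ^ 2 / (s + Δt - s))) ^ 2 ≤
        32 * ((1 - ε₀ ^ 2) * L ^ 2 / (s + Δt - s)) * q := by
      rw [add_sub_cancel_left, ← hn]; exact hq0
    have hI1 : Icc s (s + Δt) ⊆ Ioc 0 T := fun t' ht' => ⟨hs0.trans_le ht'.1, ht'.2.trans hs1T⟩
    have hsp0 := hg.spread hΩo hA'0 (yc := z) hI1 (by linarith only [hΔtpos]) hL hzL hε₀pos
      hε₀half (by positivity : 0 < η₀ * M / 2) hq2 hq0'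
      (fun t' ht' y hy => hg0 t' (hI1 ht') y (hzL hy)) hball
    have hstart : ∀ y ∈ closedBall (c 0) (L / 2), η₀ * M / 2 * c₀ ≤ M - u (s + Δt) y := by
      intro y hy
      rw [hc0] at hy
      have h := hsp0 y (mem_closedBall_iff_norm.1 hy)
      have e : η₀ * M / 2 * c₀ = η₀ * M / 2 / 2 * (ε₀ ^ 2) ^ q / ε₀ ^ 4 := by rw [hc₀]; ring
      rw [e]
      exact h
    -- the chain of spreads
    have hq1 := hqOK (1 / 4) Δt (by norm_num) (by norm_num) hΔt1 hΔt2 hΔtpos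
    rw [hn] at hq1
    have hI2 : Icc s (s + (N + 1) * Δt) ⊆ Ioc 0 T := fun t' ht' =>
      ⟨hs0.trans_le ht'.1, ht'.2.trans (le_of_eq hsΔT)⟩
    have hchainsp := hg.spread_chain hΩo hA'0 hL hΔtpos hI2 hcstat hcstep' hq2 hq1
      hg0 (by positivity) hstart N le_rfl x₀ (by rw [hcN]; exact mem_closedBall_self (by positivity))
    rw [hsΔT] at hchainsp
    have e2 : η₀ * M / 2 * c₀ * liebermanChainFactor q ^ N = 2 * (δ * M) := by rw [hδ]; ring
    rw [e2] at hchainsp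
    have hδM : 0 < δ * M := mul_pos hδpos hM
    linarith only [hchainsp, hgT, hδM]
  ------------------------------------------------------------------
  -- Claim 2: the conclusion, with a short-time localisation near `t = T`
  ------------------------------------------------------------------
  have hη₀M : η₀ * M = ε * M / 4 := by rw [hη₀]; ring
  have hεM : 0 ≤ ε * M := by positivity
  by_cases htθ : t ≤ T - θ
  · have h := claim1 t ⟨by linarith only [ht.1, hθτ, hτ], htθ⟩ x (hΩ'C hx)
    linarith only [h, hη₀M, hεM]
  · push Not at htθ
    have htb1 : τ / 2 ≤ t - θ := by linarith only [ht.1, hθτ]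
    have htb0 : 0 < t - θ := by linarith only [htb1, hτ]
    have hxr₀C : closedBall x r₀ ⊆ S' := hballC x (Or.inl (subset_closure hx))
    have hxr₀Ω : closedBall x r₀ ⊆ Ω := hxr₀C.trans hS'Ω
    have hbot : ∀ y ∈ closedBall x r₀, M - u (t - θ) y ≤ η₀ * M := fun y hy =>
      claim1 (t - θ) ⟨htb1, by linarith only [ht.2]⟩ y (hxr₀C hy)
    have hI3 : Icc (t - θ) t ⊆ Ioc 0 T := fun t' ht' => ⟨htb0.trans_le ht'.1, ht'.2.trans ht.2.le⟩
    have hcyl := hg.le_of_cylinder hΩo hA'0 hr₀pos hxr₀Ω hI3 (by linarith only [hθpos])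
      (by positivity : (0 : ℝ) ≤ 2 * M) (by positivity : (0 : ℝ) ≤ η₀ * M)
      (fun t' ht' y hy => hg2 t' (hI3 ht') y (hxr₀Ω hy)) hbot
    have hkk' : 2 * (Module.finrank ℝ E : ℝ) + 2 * A' * r₀ = kk := by rw [hkk, hn]
    rw [hkk', show t - (t - θ) = θ by ring] at hcyl
    have hbd2 : 2 * M * kk * θ / r₀ ^ 2 ≤ ε * M / 2 := by
      have h1 : kk * θ ≤ ε * r₀ ^ 2 / 4 := by
        calc kk * θ ≤ (kk + 1) * θ := by nlinarith only [hθpos, hkk0]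
          _ ≤ (kk + 1) * (ε * r₀ ^ 2 / (4 * (kk + 1))) := by gcongr
          _ = ε * r₀ ^ 2 / 4 := by field_simp
      rw [div_le_iff₀ (by positivity)]
      nlinarith only [h1, hM]
    linarith only [hcyl, hbd2, hη₀M, hεM]

end Assembly

end Literature.Analysis.FluidPDE

end
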